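import Literature.MathematicalPhysics.QuantumLattice.TIDensityPhaseCoexistence
import Literature.MathematicalPhysics.QuantumLattice.HubbardTTPrimeGroundEnergyZeeman
import Literature.MathematicalPhysics.QuantumLattice.HubbardTTPrimeThermalPressureZeemanStates
import Literature.MathematicalPhysics.QuantumLattice.HubbardTTPrimeThermalPhaseCoexistenceHotAnchor
import HarnessLib

/-!
# The FIELD AXIS of the competing-orders word: certified exclusion of macroscopic phase separation of the 2D `t–t'` Hubbard
# model IN A ZEEMAN FIELD `h`, at `T = 0` and `T > 0`, from ZERO-FIELD energy windows — margin `M ↦ M − |h|·m̄`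

Topic `Literature/MathematicalPhysics/QuantumLattice` (family `hubbard`; D-0096 (ii)+(iii) `T > 0` × competing orders, D-0098/D-0100 phase
maps over `T × P × H`). The `t–t'` model in a uniform Zeeman field `h` coupled to `N↑ − N↓` is the tree's interaction
`gcInteractionTT' t t' U 0 h = Φ(t,t',U) − h·(n↑ − n↓)` (`TIVariationalPressure`); `h` and the magnetisation `m` are a Legendre pair
exactly as `μ` and the filling `n` are. Its two fixed-filling numbers and their ZERO-FIELD WINDOWS are in the tree:

* `T = 0`: `E_h(n) := (gcInteractionTT' t t' U 0 h).tiGroundEnergyDensityAt 1 n ∈ [e(n) − |h|·min(n,2−n), e(n)]`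
  (`HubbardTTPrimeGroundEnergyZeeman`, `e = energyDensityTT'`);
* `T > 0`: `p_h(β; n) := pressureTT'Zeeman β t t' U n h = (gcInteractionTT' t t' U 0 h).varPressureAt β 1 n ∈ [p(β;n), p(β;n) + β|h|·min(n,2−n)]`
  (`HubbardTTPrimeThermalPressureZeeman{,States}`, `p = pressureTT'`).

A translation-invariant state `ω` of filling `n` is a FIELD GROUND STATE if `e_Φ(ω) − h m(ω) = E_h(n)` and a CANONICAL FIELD EQUILIBRIUM
STATE at `β` if `s̄(ω) − β(e_Φ(ω) − h m(ω)) = p_h(β; n)` (at `h = 0` every canonical sector-Gibbs torus limit is one, §3). Feeding the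
windows into the model-free laws of `TIDensityPhaseCoexistence` gives, PROVED (`U ≥ 0`):

* §1 `T = 0` (`fieldGroundEnergy_lt_meanEnergy_mix_of_cap_lt_floors_of_le`): a zero-field CAP `e(an₁ + bn₂) ≤ c` and zero-field FLOORS
  `f_i ≤ e(n_i)` with `c + |h|·(a·min(n₁,2−n₁) + b·min(n₂,2−n₂)) < a f₁ + b f₂` exclude, AT THE FIELD `h`, every macroscopic mixture of
  translation-invariant states with densities `ρ(ω₁) ≤ n₁ < n₂ ≤ ρ(ω₂)` from being a field ground state at any mean density; hole-doped
  form (`n₂ ≤ 1`): the field cost is `|h|·(an₁ + bn₂)` — **a zero-field margin `M` survives every field `|h| < M/(an₁+bn₂)`**; threshold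
  form `|h| ≤ h₀`.
* §2 `T > 0` (`sub_mul_field_lt_pressureTT'Zeeman_mix_of_hotAnchors_of_le`): the HOT-ANCHORED energy-window law
  (`HubbardTTPrimeThermalPhaseCoexistenceHotAnchor`: cap `c`, floors `f_i`, zero-field pressure ceilings `p(β_{h,i}; n_i) ≤ π_i` at hotter
  `β_{h,i} ≤ β`) excludes the coexistence in every canonical field equilibrium state at `β` as soon as
  `aπ₁ + bπ₂ + β_{h,1}af₁ + β_{h,2}bf₂ < β·(af₁ + bf₂ − c − |h|·m̄)` — the zero-field threshold with `M ↦ M − |h|·m̄`; hole-doped threshold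
  form «for every `β ≥ β₀` and every `|h| ≤ h₀`».
* §3 `h = 0`: `p_0 = p` and every canonical sector-Gibbs torus-limit state is a canonical field equilibrium state at `h = 0`
  (`IsTorusLimitOfMixture.pressureTT'Zeeman_zero_le_sub_mul_of_sectorGibbs`), so the §2 conclusion at `h = 0` contains the zero-field law.

READING (how instances print it): with `h = μ_B·B` (`g = 2`) and `t ≈ 0.35 eV` [float], `|h| ≤ t/100` is `B ≲ 60 T` — every laboratory
DC / long-pulse field; the competing-orders CONTROL word is CONSTANT along the entire laboratory `H` axis of the phase map whenever its
zero-field margin exceeds `n̄·t/100`.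
HONEST SCOPE: Zeeman coupling only (no orbital coupling of the field, no Peierls phases); exclusion of MACROSCOPIC coexistence (mixtures of
translation-invariant states); the `T > 0` statement is about canonical field equilibrium states in the variational sense (which at `h = 0`
include every sector-Gibbs torus limit); inputs are zero-field claim nodes / kernel rows of the instance files; nothing about stripes,
which phase is realised, superconductivity or `T_c`. Everything is PROVED; no definition, no named fact, no number. Written 2026-08-28 by
hubbard-downfold-unc-2 (g21; cell `pub/hubbard-downfold`, MO-S1 ↔ S2 seam, filling direction).

## Mathlib / tree search
REUSED: `IsTranslationInvariant.tiGroundEnergyDensityAt_lt_meanEnergy_mix_of_cap_lt_floors_of_le`,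
`IsTranslationInvariant.sub_mul_lt_varPressureAt_mix_of_caps_lt_floor_of_le` (`TIDensityPhaseCoexistence`);
`tiGroundEnergyDensityAt_field_le_energyDensityTT'`, `energyDensityTT'_sub_le_tiGroundEnergyDensityAt_field` (`HubbardTTPrimeGroundEnergyZeeman`);
`varPressureAt_gcInteractionTT'_field_eq_pressureTT'Zeeman` (`…ThermalPressureZeemanStates`), `pressureTT'_le_pressureTT'Zeeman`,
`pressureTT'Zeeman_le_pressureTT'_add`, `pressureTT'Zeeman_zero` (`…ThermalPressureZeeman`); `pressureTT'_mem_Icc` (`…ThermalPressureLimit`);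
`pressureTT'_le_hotCeiling_sub_mul_of_floor` (`…ThermalPhaseCoexistenceHotAnchor`); `IsTorusLimitOfMixture.entropyDensitySup_sub_mul_eq_pressureTT'_of_sectorGibbs`,
`density_eq_of_sectorGibbs`; `InfVolFermionState.meanEnergy_gcInteractionTT'_eq`. `lean search 'Zeeman.*mix|coexist.*field'` (2026-08-28): nothing.

## References
* R. B. Israel, *Convexity in the Theory of Lattice Gases* (1979), Thm. I.2.4. [cite: Israel1979, Thm. I.2.4]
* R. B. Griffiths, J. Math. Phys. 5 (1964) 1215, Appendix (convexity in the field). [cite: Griffiths1964, Appendix]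
* E. H. Lieb, Phys. Rev. Lett. 62 (1989) 1201, proof of Thm. 1 (`S^z`-sector dominance). [cite: LiebPRL1989, proof of Theorem 1]
* V. J. Emery, S. A. Kivelson, H. Q. Lin, Phys. Rev. Lett. 64 (1990) 475. [cite: EmeryKivelsonLin1990, pp. 475–476]
* D. Ruelle, *Statistical Mechanics: Rigorous Results* (1969), §3.4. [cite: Ruelle1969, §3.4]
-/

noncomputable section

open scoped ComplexOrder BigOperators
open Filter Topology Set

namespace Literature.MathematicalPhysics.QuantumLattice

open Matrix HubbardWave0 Literature.Probability.LatticeModels ThermodynamicLimit InfVolFermionState FermionInteraction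

/-- The field functional at `μ = 0`: `e_{Φ − h m}(ω) = e_Φ(ω) − h·m(ω)`. [cite: Ruelle1969, §3.4] -/
private theorem meanEnergy_gc_zero_field (ω : InfVolFermionState 2) (t t' U hz : ℝ) :
    ω.meanEnergy (gcInteractionTT' t t' U 0 hz) 1 =
      ω.meanEnergy (hubbardTTPrimeFermionInteraction t t' U) 1 - hz * ω.meanEnergy (spinImbalanceInteraction 2) 1 := by
  rw [ω.meanEnergy_gcInteractionTT'_eq]; ring

/-- Weights: `a n₁ + b n₂ ∈ [n₁, n₂]` for `a, b ≥ 0`, `a + b = 1`, `n₁ ≤ n₂`. [folklore] -/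
private theorem convexComb_mem_Icc {a b n₁ n₂ : ℝ} (ha : 0 ≤ a) (hb : 0 ≤ b) (hab : a + b = 1) (h : n₁ ≤ n₂) :
    n₁ ≤ a * n₁ + b * n₂ ∧ a * n₁ + b * n₂ ≤ n₂ := by
  have e1 : a * n₁ + b * n₂ = n₁ + b * (n₂ - n₁) := by
    have ha' : a = 1 - b := by linarith
    rw [ha']; ring
  have e2 : a * n₁ + b * n₂ = n₂ - a * (n₂ - n₁) := by
    have hb' : b = 1 - a := by linarith
    rw [hb']; ring
  constructor
  · rw [e1]; nlinarith [mul_nonneg hb (sub_nonneg.2 h)]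
  · rw [e2]; nlinarith [mul_nonneg ha (sub_nonneg.2 h)]

namespace InfVolFermionState

/-! ### §1 `T = 0`: field ground states -/

section FieldGround

variable (t t' : ℝ) {U : ℝ} (hU : 0 ≤ U) (hz : ℝ) {ω₁ ω₂ : InfVolFermionState 2}
include hU

/-- **`T = 0` competing-orders word in a Zeeman field from ZERO-FIELD windows.** `U ≥ 0`; translation-invariant `ω₁, ω₂` with
`0 < ρ(ω₁) ≤ n₁ < n₂ ≤ ρ(ω₂) < 2`; weights `a, b ≥ 0`, `a + b = 1`; a zero-field CAP `e(an₁ + bn₂) ≤ c` and zero-field FLOORS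
`f₁ ≤ e(n₁)`, `f₂ ≤ e(n₂)` with `c + |h|·(a·min(n₁,2−n₁) + b·min(n₂,2−n₂)) < a f₁ + b f₂`. Then for every `0 < λ < 1` the mixture
`λω₁ + (1−λ)ω₂` is NOT a field ground state at its filling: `E_h(ρ(mix)) < e_Φ(mix) − h·m(mix)`. (The field window turns the zero-field
floors into field floors `f_i − |h|·min(n_i,2−n_i)` and keeps the cap, `E_h ≤ e`.) [cite: Israel1979, Thm. I.2.4] [cite: Griffiths1964, Appendix] -/
theorem IsTranslationInvariant.fieldGroundEnergy_lt_meanEnergy_mix_of_cap_lt_floors_of_le (h₁ : ω₁.IsTranslationInvariant)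
    (h₂ : ω₂.IsTranslationInvariant) (hρ₁0 : 0 < ω₁.density) (hρ₂2 : ω₂.density < 2)
    {n₁ n₂ : ℝ} (hn₁ : ω₁.density ≤ n₁) (hn12 : n₁ < n₂) (hn₂ : n₂ ≤ ω₂.density)
    {a b : ℝ} (ha : 0 ≤ a) (hb : 0 ≤ b) (hab : a + b = 1) {c f₁ f₂ : ℝ}
    (hcap : energyDensityTT' t t' U (a * n₁ + b * n₂) ≤ c)
    (hf₁ : f₁ ≤ energyDensityTT' t t' U n₁) (hf₂ : f₂ ≤ energyDensityTT' t t' U n₂)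
    (hM : c + |hz| * (a * min n₁ (2 - n₁) + b * min n₂ (2 - n₂)) < a * f₁ + b * f₂)
    {lam : ℝ} (hl0 : 0 < lam) (hl1 : lam < 1) :
    (gcInteractionTT' t t' U 0 hz).tiGroundEnergyDensityAt 1 (InfVolFermionState.mix lam hl0.le hl1.le ω₁ ω₂).density <
      (InfVolFermionState.mix lam hl0.le hl1.le ω₁ ω₂).meanEnergy (gcInteractionTT' t t' U 0 hz) 1 := by
  have hn₁0 : 0 < n₁ := lt_of_lt_of_le hρ₁0 hn₁
  have hn₁2 : n₁ < 2 := by linarith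
  have hn₂0 : 0 < n₂ := by linarith
  have hn₂2 : n₂ < 2 := lt_of_le_of_lt hn₂ hρ₂2
  obtain ⟨hmlo, hmhi⟩ := convexComb_mem_Icc ha hb hab hn12.le
  have hm0 : 0 < a * n₁ + b * n₂ := lt_of_lt_of_le hn₁0 hmlo
  have hm2 : a * n₁ + b * n₂ < 2 := lt_of_le_of_lt hmhi hn₂2
  have hcap' := (tiGroundEnergyDensityAt_field_le_energyDensityTT' t t' hU hm0 hm2 hz).trans hcap
  have hf₁' := energyDensityTT'_sub_le_tiGroundEnergyDensityAt_field t t' hU hn₁0 hn₁2 hz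
  have hf₂' := energyDensityTT'_sub_le_tiGroundEnergyDensityAt_field t t' hU hn₂0 hn₂2 hz
  refine h₁.tiGroundEnergyDensityAt_lt_meanEnergy_mix_of_cap_lt_floors_of_le (gcInteractionTT' t t' U 0 hz) 1 h₂ hn₁ hn12 hn₂
    ha hb hab hcap' (f₁ := f₁ - |hz| * min n₁ (2 - n₁)) (f₂ := f₂ - |hz| * min n₂ (2 - n₂))
    (by linarith) (by linarith) ?_ hl0 hl1
  have e : a * (f₁ - |hz| * min n₁ (2 - n₁)) + b * (f₂ - |hz| * min n₂ (2 - n₂)) =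
      a * f₁ + b * f₂ - |hz| * (a * min n₁ (2 - n₁) + b * min n₂ (2 - n₂)) := by ring
  rw [e]
  linarith

/-- **Hole-doped form** (`n₂ ≤ 1`, so `min(n_i, 2−n_i) = n_i` and the field cost is `|h|·(an₁ + bn₂)`, the magnetisation a fully
polarised phase could carry at the defect's density): `c + |h|·(an₁ + bn₂) < a f₁ + b f₂` excludes the `(≤ n₁ ∣ ≥ n₂)` coexistence
among field ground states at the field `h` — a zero-field margin `M = af₁ + bf₂ − c` SURVIVES EVERY FIELD `|h| < M/(an₁ + bn₂)`.
[cite: Israel1979, Thm. I.2.4] [cite: LiebPRL1989, proof of Theorem 1] -/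
theorem IsTranslationInvariant.fieldGroundEnergy_lt_meanEnergy_mix_of_cap_lt_floors_of_le_one (h₁ : ω₁.IsTranslationInvariant)
    (h₂ : ω₂.IsTranslationInvariant) (hρ₁0 : 0 < ω₁.density) (hρ₂2 : ω₂.density < 2)
    {n₁ n₂ : ℝ} (hn₁ : ω₁.density ≤ n₁) (hn12 : n₁ < n₂) (hn₂ : n₂ ≤ ω₂.density) (hn₂1 : n₂ ≤ 1)
    {a b : ℝ} (ha : 0 ≤ a) (hb : 0 ≤ b) (hab : a + b = 1) {c f₁ f₂ : ℝ}
    (hcap : energyDensityTT' t t' U (a * n₁ + b * n₂) ≤ c)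
    (hf₁ : f₁ ≤ energyDensityTT' t t' U n₁) (hf₂ : f₂ ≤ energyDensityTT' t t' U n₂)
    (hM : c + |hz| * (a * n₁ + b * n₂) < a * f₁ + b * f₂)
    {lam : ℝ} (hl0 : 0 < lam) (hl1 : lam < 1) :
    (gcInteractionTT' t t' U 0 hz).tiGroundEnergyDensityAt 1 (InfVolFermionState.mix lam hl0.le hl1.le ω₁ ω₂).density <
      (InfVolFermionState.mix lam hl0.le hl1.le ω₁ ω₂).meanEnergy (gcInteractionTT' t t' U 0 hz) 1 := by
  have e1 : min n₁ (2 - n₁) = n₁ := min_eq_left (by linarith)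
  have e2 : min n₂ (2 - n₂) = n₂ := min_eq_left (by linarith)
  refine h₁.fieldGroundEnergy_lt_meanEnergy_mix_of_cap_lt_floors_of_le t t' hU hz h₂ hρ₁0 hρ₂2 hn₁ hn12 hn₂ ha hb hab hcap
    hf₁ hf₂ ?_ hl0 hl1
  rw [e1, e2]
  exact hM

/-- **Threshold form in the field** (hole-doped, `n₂ ≤ 1`): if `c + h₀·(an₁ + bn₂) < a f₁ + b f₂` then the coexistence is excluded among
field ground states at EVERY field `|h| ≤ h₀` — how instances print «for every `|h| ≤ t/100`». [cite: Israel1979, Thm. I.2.4] -/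
theorem IsTranslationInvariant.fieldGroundEnergy_lt_meanEnergy_mix_of_cap_lt_floors_of_abs_le (h₁ : ω₁.IsTranslationInvariant)
    (h₂ : ω₂.IsTranslationInvariant) (hρ₁0 : 0 < ω₁.density) (hρ₂2 : ω₂.density < 2)
    {n₁ n₂ : ℝ} (hn₁ : ω₁.density ≤ n₁) (hn12 : n₁ < n₂) (hn₂ : n₂ ≤ ω₂.density) (hn₂1 : n₂ ≤ 1)
    {a b : ℝ} (ha : 0 ≤ a) (hb : 0 ≤ b) (hab : a + b = 1) {c f₁ f₂ h₀ : ℝ}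
    (hcap : energyDensityTT' t t' U (a * n₁ + b * n₂) ≤ c)
    (hf₁ : f₁ ≤ energyDensityTT' t t' U n₁) (hf₂ : f₂ ≤ energyDensityTT' t t' U n₂)
    (hh : |hz| ≤ h₀) (hM₀ : c + h₀ * (a * n₁ + b * n₂) < a * f₁ + b * f₂)
    {lam : ℝ} (hl0 : 0 < lam) (hl1 : lam < 1) :
    (gcInteractionTT' t t' U 0 hz).tiGroundEnergyDensityAt 1 (InfVolFermionState.mix lam hl0.le hl1.le ω₁ ω₂).density <
      (InfVolFermionState.mix lam hl0.le hl1.le ω₁ ω₂).meanEnergy (gcInteractionTT' t t' U 0 hz) 1 := by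
  have hn₁0 : 0 < n₁ := lt_of_lt_of_le hρ₁0 hn₁
  have hm0 : 0 ≤ a * n₁ + b * n₂ := add_nonneg (mul_nonneg ha hn₁0.le) (mul_nonneg hb (by linarith))
  refine h₁.fieldGroundEnergy_lt_meanEnergy_mix_of_cap_lt_floors_of_le_one t t' hU hz h₂ hρ₁0 hρ₂2 hn₁ hn12 hn₂ hn₂1 ha hb hab
    hcap hf₁ hf₂ ?_ hl0 hl1
  nlinarith [mul_le_mul_of_nonneg_right hh hm0]

end FieldGround

/-! ### §2 `T > 0`: canonical field equilibrium states, hot-anchored energy-window form -/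

section FieldThermal

variable (t t' : ℝ) {U : ℝ} (hU : 0 ≤ U) {β : ℝ} (hβ : 0 < β) (hz : ℝ) {ω₁ ω₂ : InfVolFermionState 2}
include hU hβ

/-- **`T > 0` competing-orders word in a Zeeman field, hot-anchored energy-window form.** `U ≥ 0`, `β > 0`; translation-invariant
`ω₁, ω₂` with `0 < ρ(ω₁) ≤ n₁ < n₂ ≤ ρ(ω₂) < 2`; weights `a, b ≥ 0`, `a + b = 1`; zero-field inputs: a ground-state energy CAP
`e(an₁ + bn₂) ≤ c`, FLOORS `f_i ≤ e(n_i)`, pressure ceilings `p(β_{h,i}; n_i) ≤ π_i` at hotter `0 ≤ β_{h,i} ≤ β`; and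
`aπ₁ + bπ₂ + β_{h,1}(af₁) + β_{h,2}(bf₂) < β·(af₁ + bf₂ − c − |h|·(a·min(n₁,2−n₁) + b·min(n₂,2−n₂)))`. Then for every `0 < λ < 1` the
mixture `λω₁ + (1−λ)ω₂` is NOT a canonical field equilibrium state at `β`: `s̄(mix) − β(e_Φ(mix) − h m(mix)) < p_h(β; ρ(mix))`.
(Field floor at the mean density `p_h ≥ p ≥ −βe ≥ −βc`; field caps at the outer densities
`p_h(n_i) ≤ p(β; n_i) + β|h|·min(n_i,2−n_i) ≤ π_i − (β − β_{h,i})f_i + β|h|·min(n_i,2−n_i)`.) [cite: Israel1979, Thm. I.2.4]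
[cite: LiebPRL1989, proof of Theorem 1] -/
theorem IsTranslationInvariant.sub_mul_field_lt_pressureTT'Zeeman_mix_of_hotAnchors_of_le (h₁ : ω₁.IsTranslationInvariant)
    (h₂ : ω₂.IsTranslationInvariant) (hρ₁0 : 0 < ω₁.density) (hρ₂2 : ω₂.density < 2)
    {n₁ n₂ : ℝ} (hn₁ : ω₁.density ≤ n₁) (hn12 : n₁ < n₂) (hn₂ : n₂ ≤ ω₂.density)
    {a b : ℝ} (ha : 0 ≤ a) (hb : 0 ≤ b) (hab : a + b = 1) {c f₁ f₂ : ℝ}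
    (hcap : energyDensityTT' t t' U (a * n₁ + b * n₂) ≤ c)
    (hf₁ : f₁ ≤ energyDensityTT' t t' U n₁) (hf₂ : f₂ ≤ energyDensityTT' t t' U n₂)
    {βh₁ βh₂ π₁ π₂ : ℝ} (hβh₁ : 0 ≤ βh₁) (hβh₂ : 0 ≤ βh₂) (hle₁ : βh₁ ≤ β) (hle₂ : βh₂ ≤ β)
    (hπ₁ : pressureTT' βh₁ t t' U n₁ ≤ π₁) (hπ₂ : pressureTT' βh₂ t t' U n₂ ≤ π₂)
    (hM : a * π₁ + b * π₂ + βh₁ * (a * f₁) + βh₂ * (b * f₂) <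
      β * (a * f₁ + b * f₂ - c - |hz| * (a * min n₁ (2 - n₁) + b * min n₂ (2 - n₂))))
    {lam : ℝ} (hl0 : 0 < lam) (hl1 : lam < 1) :
    (InfVolFermionState.mix lam hl0.le hl1.le ω₁ ω₂).entropyDensitySup -
        β * (InfVolFermionState.mix lam hl0.le hl1.le ω₁ ω₂).meanEnergy (gcInteractionTT' t t' U 0 hz) 1 <
      pressureTT'Zeeman β t t' U (InfVolFermionState.mix lam hl0.le hl1.le ω₁ ω₂).density hz := by
  have hn₁0 : 0 < n₁ := lt_of_lt_of_le hρ₁0 hn₁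
  have hn₁2 : n₁ < 2 := by linarith
  have hn₂0 : 0 < n₂ := by linarith
  have hn₂2 : n₂ < 2 := lt_of_le_of_lt hn₂ hρ₂2
  obtain ⟨hmlo, hmhi⟩ := convexComb_mem_Icc ha hb hab hn12.le
  have hm0 : 0 < a * n₁ + b * n₂ := lt_of_lt_of_le hn₁0 hmlo
  have hm2 : a * n₁ + b * n₂ < 2 := lt_of_le_of_lt hmhi hn₂2
  -- the mixture's density lies in `(0, 2)`
  have hρ₁2 : ω₁.density < 2 := by linarith
  have hρ₂0 : 0 < ω₂.density := by linarith
  have hmix0 : 0 < (InfVolFermionState.mix lam hl0.le hl1.le ω₁ ω₂).density := by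
    rw [density_mix]; nlinarith [mul_pos hl0 hρ₁0, mul_pos (sub_pos.2 hl1) hρ₂0]
  have hmix2 : (InfVolFermionState.mix lam hl0.le hl1.le ω₁ ω₂).density < 2 := by
    rw [density_mix]; nlinarith [mul_lt_mul_of_pos_left hρ₁2 hl0, mul_lt_mul_of_pos_left hρ₂2 (sub_pos.2 hl1)]
  -- field pressure floor at the mean density
  have hW : -(β * c) ≤ (gcInteractionTT' t t' U 0 hz).varPressureAt β 1 (a * n₁ + b * n₂) := by
    rw [varPressureAt_gcInteractionTT'_field_eq_pressureTT'Zeeman hβ t t' hU hm0 hm2 hz]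
    have h1 := (pressureTT'_mem_Icc hβ.le t t' hU hm0.le hm2).1
    have h2 := pressureTT'_le_pressureTT'Zeeman hβ.le t t' hU hm0.le hm2 hz
    nlinarith [mul_le_mul_of_nonneg_left hcap hβ.le]
  -- field pressure caps at the outer densities
  have hQ₁ : (gcInteractionTT' t t' U 0 hz).varPressureAt β 1 n₁ ≤ π₁ - (β - βh₁) * f₁ + β * |hz| * min n₁ (2 - n₁) := by
    rw [varPressureAt_gcInteractionTT'_field_eq_pressureTT'Zeeman hβ t t' hU hn₁0 hn₁2 hz]
    have h1 := pressureTT'Zeeman_le_pressureTT'_add hβ.le t t' hU hn₁0.le hn₁2 hz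
    have h2 := pressureTT'_le_hotCeiling_sub_mul_of_floor t t' hU hn₁0.le hn₁2 hβh₁ hle₁ hπ₁ hf₁
    linarith
  have hQ₂ : (gcInteractionTT' t t' U 0 hz).varPressureAt β 1 n₂ ≤ π₂ - (β - βh₂) * f₂ + β * |hz| * min n₂ (2 - n₂) := by
    rw [varPressureAt_gcInteractionTT'_field_eq_pressureTT'Zeeman hβ t t' hU hn₂0 hn₂2 hz]
    have h1 := pressureTT'Zeeman_le_pressureTT'_add hβ.le t t' hU hn₂0.le hn₂2 hz
    have h2 := pressureTT'_le_hotCeiling_sub_mul_of_floor t t' hU hn₂0.le hn₂2 hβh₂ hle₂ hπ₂ hf₂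
    linarith
  have key := h₁.sub_mul_lt_varPressureAt_mix_of_caps_lt_floor_of_le (by norm_num : 0 < 2) β (gcInteractionTT' t t' U 0 hz) 1
    h₂ hn₁ hn12 hn₂ ha hb hab hW hQ₁ hQ₂ ?_ hl0 hl1
  · rwa [varPressureAt_gcInteractionTT'_field_eq_pressureTT'Zeeman hβ t t' hU hmix0 hmix2 hz] at key
  · have e : a * (π₁ - (β - βh₁) * f₁ + β * |hz| * min n₁ (2 - n₁)) + b * (π₂ - (β - βh₂) * f₂ + β * |hz| * min n₂ (2 - n₂)) =
        a * π₁ + b * π₂ + βh₁ * (a * f₁) + βh₂ * (b * f₂) - β * (a * f₁ + b * f₂) +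
          β * (|hz| * (a * min n₁ (2 - n₁) + b * min n₂ (2 - n₂))) := by ring
    rw [e]
    have e2 : β * (a * f₁ + b * f₂ - c - |hz| * (a * min n₁ (2 - n₁) + b * min n₂ (2 - n₂))) =
        β * (a * f₁ + b * f₂) - β * c - β * (|hz| * (a * min n₁ (2 - n₁) + b * min n₂ (2 - n₂))) := by ring
    rw [e2] at hM
    linarith

/-- **Threshold form in the field, hole-doped** (`n₂ ≤ 1`, field cost `|h|·(an₁ + bn₂)`): with
`M₀ := af₁ + bf₂ − c − h₀·(an₁ + bn₂) ≥ 0`, `aπ₁ + bπ₂ + β_{h,1}af₁ + β_{h,2}bf₂ < β₀·M₀` and `β_{h,i} ≤ β₀ ≤ β`, `|h| ≤ h₀`: the coexistence is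
excluded among canonical field equilibrium states at `β` — how instances print «for every `β ≥ β₀` and every `|h| ≤ h₀`» with ONE rational
check. [cite: Israel1979, Thm. I.2.4] [cite: LiebPRL1989, proof of Theorem 1] -/
theorem IsTranslationInvariant.sub_mul_field_lt_pressureTT'Zeeman_mix_of_hotAnchors_of_threshold_of_abs_le
    (h₁ : ω₁.IsTranslationInvariant) (h₂ : ω₂.IsTranslationInvariant) (hρ₁0 : 0 < ω₁.density) (hρ₂2 : ω₂.density < 2)
    {n₁ n₂ : ℝ} (hn₁ : ω₁.density ≤ n₁) (hn12 : n₁ < n₂) (hn₂ : n₂ ≤ ω₂.density) (hn₂1 : n₂ ≤ 1)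
    {a b : ℝ} (ha : 0 ≤ a) (hb : 0 ≤ b) (hab : a + b = 1) {c f₁ f₂ : ℝ}
    (hcap : energyDensityTT' t t' U (a * n₁ + b * n₂) ≤ c)
    (hf₁ : f₁ ≤ energyDensityTT' t t' U n₁) (hf₂ : f₂ ≤ energyDensityTT' t t' U n₂)
    {βh₁ βh₂ π₁ π₂ β₀ h₀ : ℝ} (hβh₁ : 0 ≤ βh₁) (hβh₂ : 0 ≤ βh₂) (h0₁ : βh₁ ≤ β₀) (h0₂ : βh₂ ≤ β₀) (hβ₀ : β₀ ≤ β)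
    (hπ₁ : pressureTT' βh₁ t t' U n₁ ≤ π₁) (hπ₂ : pressureTT' βh₂ t t' U n₂ ≤ π₂) (hh : |hz| ≤ h₀)
    (hMnn : 0 ≤ a * f₁ + b * f₂ - c - h₀ * (a * n₁ + b * n₂))
    (hM₀ : a * π₁ + b * π₂ + βh₁ * (a * f₁) + βh₂ * (b * f₂) < β₀ * (a * f₁ + b * f₂ - c - h₀ * (a * n₁ + b * n₂)))
    {lam : ℝ} (hl0 : 0 < lam) (hl1 : lam < 1) :
    (InfVolFermionState.mix lam hl0.le hl1.le ω₁ ω₂).entropyDensitySup -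
        β * (InfVolFermionState.mix lam hl0.le hl1.le ω₁ ω₂).meanEnergy (gcInteractionTT' t t' U 0 hz) 1 <
      pressureTT'Zeeman β t t' U (InfVolFermionState.mix lam hl0.le hl1.le ω₁ ω₂).density hz := by
  have hn₁0 : 0 < n₁ := lt_of_lt_of_le hρ₁0 hn₁
  have e1 : min n₁ (2 - n₁) = n₁ := min_eq_left (by linarith)
  have e2 : min n₂ (2 - n₂) = n₂ := min_eq_left (by linarith)
  have hm0 : 0 ≤ a * n₁ + b * n₂ := add_nonneg (mul_nonneg ha hn₁0.le) (mul_nonneg hb (by linarith))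
  refine h₁.sub_mul_field_lt_pressureTT'Zeeman_mix_of_hotAnchors_of_le t t' hU hβ hz h₂ hρ₁0 hρ₂2 hn₁ hn12 hn₂ ha hb hab hcap
    hf₁ hf₂ hβh₁ hβh₂ (h0₁.trans hβ₀) (h0₂.trans hβ₀) hπ₁ hπ₂ ?_ hl0 hl1
  rw [e1, e2]
  -- `N < β₀ M₀ ≤ β M₀ ≤ β M_{|h|}`
  have k1 : β₀ * (a * f₁ + b * f₂ - c - h₀ * (a * n₁ + b * n₂)) ≤ β * (a * f₁ + b * f₂ - c - h₀ * (a * n₁ + b * n₂)) :=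
    mul_le_mul_of_nonneg_right hβ₀ hMnn
  have k2 : β * (a * f₁ + b * f₂ - c - h₀ * (a * n₁ + b * n₂)) ≤ β * (a * f₁ + b * f₂ - c - |hz| * (a * n₁ + b * n₂)) :=
    mul_le_mul_of_nonneg_left (by nlinarith [mul_le_mul_of_nonneg_right hh hm0]) hβ.le
  linarith

end FieldThermal

/-! ### §3 `h = 0`: the canonical sector-Gibbs torus limits are canonical field equilibrium states -/

section ZeroField

variable (t t' : ℝ) {U : ℝ} (hU : 0 ≤ U) {β : ℝ} (hβ : 0 < β) {ω : InfVolFermionState 2} {Ls : ℕ → ℕ} {n : ℝ}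
include hU hβ

/-- **At `h = 0` every canonical thermal torus-limit state attains the field pressure at its filling**: for a torus limit `ω` of the
canonical sector-Gibbs states at `(β; t,t',U; n)`, `p_0(β; ρ(ω)) ≤ s̄(ω) − β·e_{Φ − 0·m}(ω)` (indeed `=`: `p_0 = p`, `ρ(ω) = n`,
`s̄(ω) − βe_Φ(ω) = p(β; n)`). Hence the §2 exclusions at `h = 0` contain the zero-field law of `…ThermalPhaseCoexistenceHotAnchor`.
[cite: Israel1979, Thm. I.2.4] [cite: Ruelle1969, §3.4] -/
theorem IsTorusLimitOfMixture.pressureTT'Zeeman_zero_le_sub_mul_of_sectorGibbs (hn0 : 0 < n) (hn2 : n < 2)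
    (h : ω.IsTorusLimitOfMixture (sectorGibbsCount n) (fun L => sectorGibbsWeightTT' β t t' U n L)
      (fun L => sectorGibbsVectorTT' t t' U n L) Ls)
    (hLs : Tendsto Ls atTop atTop) :
    pressureTT'Zeeman β t t' U ω.density 0 ≤ ω.entropyDensitySup - β * ω.meanEnergy (gcInteractionTT' t t' U 0 0) 1 := by
  have hρ := h.density_eq_of_sectorGibbs t t' U hn0.le hn2.le β hLs
  have heq := h.entropyDensitySup_sub_mul_eq_pressureTT'_of_sectorGibbs t t' hU hβ hn0 hn2 hLs
  rw [hρ, pressureTT'Zeeman_zero hβ.le t t' hU hn0.le hn2, meanEnergy_gc_zero_field, zero_mul, sub_zero]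
  exact heq.ge

/-- **Consistency at `h = 0`**: a state whose zero-field free-energy functional is STRICTLY below `p_0(β; ρ(ω))` is not a canonical
sector-Gibbs torus limit at `(β; ρ(ω))` — the §2 conclusion at `h = 0` implies the `¬ IsTorusLimitOfMixture` conclusion of the zero-field
files. [cite: Israel1979, Thm. I.2.4] -/
theorem not_isTorusLimitOfMixture_of_sub_mul_lt_pressureTT'Zeeman_zero (hn0 : 0 < n) (hn2 : n < 2)
    (hlt : ω.entropyDensitySup - β * ω.meanEnergy (gcInteractionTT' t t' U 0 0) 1 < pressureTT'Zeeman β t t' U ω.density 0)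
    (hLs : Tendsto Ls atTop atTop) :
    ¬ ω.IsTorusLimitOfMixture (sectorGibbsCount n) (fun L => sectorGibbsWeightTT' β t t' U n L)
      (fun L => sectorGibbsVectorTT' t t' U n L) Ls := fun h =>
  absurd (h.pressureTT'Zeeman_zero_le_sub_mul_of_sectorGibbs t t' hU hβ hn0 hn2 hLs) (not_le.2 hlt)

end ZeroField

end InfVolFermionState

end Literature.MathematicalPhysics.QuantumLattice

end
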